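import Summits.ValiantsHypothesis.ValiantsHypothesis.Theorems.LacunarySymmetroidMatrixDescartesCensusV19SSoundCerts
import Summits.ValiantsHypothesis.ValiantsHypothesis.Theorems.LacunarySymmetroidMatrixDescartesCensusV20SoundCoeffs

/-!
# `MatrixDescartes` census — soundness of the 2-SIDON `V = 19` checker: the `21` sums, the `20` live sums, weights as the checker computes them

HONEST FRAMING.  Object-search cell `pub-symmetroid`; door-A item `DoorA26 = PosRootLawAt 2 6 19`
(stmt-ValiantsHypothesis-19979; OPEN, typed, never asserted).  Bookkeeping for the proof that a nineteen on a 2-Sidon support yields a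
`V19S.Model` (`…CensusV19SSoundNineteen`): the list `E = V20.sums d ord` of the `21` pair sums (length, strict increase, access by position,
the support of the pencil determinant lies in it — from `…CensusV20SoundCoeffs`), the list of the `20` live sums `E.eraseIdx z` with the
position map `V19S.liveSlot`, and the dictionary between the support-form gap weights of the tree's row theorems (`∏_{u ∈ supp} |e − u|`,
with or without the window factors) and the checker's factored naturals (`V20.dist1`, `V19S.redW`), plus the algebraic repackaging of a
Newton-cone inequality into the checker's row `V20.rowC25`.  Nothing here bears on the one-collision supports, on `ζ_sym(2,6)` over all
supports, on `DoorA26` itself, on `MatrixDescartes` (stmt-ValiantsHypothesis-18050) or on `VP ≠ VNP`.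

[folklore] Bookkeeping; elementary.
-/

-- the D-0017 layout repeats a namespace component (single-conjunct summit); the `dupNamespace` linter flags it; name mandated.
set_option linter.dupNamespace false

namespace Summit.ValiantsHypothesis.ValiantsHypothesis.Theorems.LacunarySymmetroidMatrixDescartes.Census.V19S

open V20 (Atom allAtoms psum posOf ordOK sums qA cA Term PolySpec posl FNat fval Row rowC25 FRat negAt Epos aval pdet dfun dist1
  lprod lprod_append lprod_replicate fval_append fval_map_const fval_cons fval_nil ordOK_spec Epos_eq_getElem Epos_lt Epos_le Epos_posOf
  posOf_lt getElem_mem_allAtoms support_subset sums_nodup sums_getD dist1_cast_of_ne dist1_pos getD_posOf)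

open Polynomial Finset
open scoped BigOperators Polynomial

section Lists

/-! ### Gap weights over a list of exponents -/

/-- Over a duplicate-free list, the gap weight `∏_{u ≠ e} |e − u|` is the checker's `∏ dist1 e u`. [folklore] -/
theorem prod_erase_abs_eq (L : List ℕ) (hL : L.Nodup) (e : ℕ) :
    ∏ u ∈ L.toFinset.erase e, |(e : ℝ) - u| = (((L.map (dist1 e)).prod : ℕ) : ℝ) := by
  have h1 : ∏ u ∈ L.toFinset.erase e, |(e : ℝ) - u| = ∏ u ∈ L.toFinset.erase e, ((dist1 e u : ℕ) : ℝ) :=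
    Finset.prod_congr rfl fun u hu => (dist1_cast_of_ne (Finset.ne_of_mem_erase hu)).symm
  rw [h1, Finset.prod_erase _ (by simp [dist1]), List.prod_toFinset _ hL, Nat.cast_list_prod, List.map_map]
  rfl

/-- Over a duplicate-free list, the gap weight written with the `u = e` factor set to `1` is the checker's `∏ dist1 e u`. [folklore] -/
theorem prod_ite_abs_eq (L : List ℕ) (hL : L.Nodup) (e : ℕ) :
    ∏ u ∈ L.toFinset, (if u = e then (1 : ℝ) else |(e : ℝ) - u|) = (((L.map (dist1 e)).prod : ℕ) : ℝ) := by
  have h1 : ∏ u ∈ L.toFinset, (if u = e then (1 : ℝ) else |(e : ℝ) - u|) = ∏ u ∈ L.toFinset, ((dist1 e u : ℕ) : ℝ) := by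
    refine Finset.prod_congr rfl fun u _ => ?_
    split_ifs with hu
    · subst hu; simp [dist1]
    · exact (dist1_cast_of_ne hu).symm
  rw [h1, List.prod_toFinset _ hL, Nat.cast_list_prod, List.map_map]
  rfl

/-- Over a duplicate-free list, the REDUCED window weight (window factors set to `1`) is the value of the checker's `redW … 1`,
for an exponent `e` inside the window. [folklore] -/
theorem prod_ite4_eq_redW (L : List ℕ) (hL : L.Nodup) (a b c d e : ℕ) (he : e = a ∨ e = b ∨ e = c ∨ e = d) :
    ∏ u ∈ L.toFinset, (if u = a ∨ u = b ∨ u = c ∨ u = d then (1 : ℝ) else |(e : ℝ) - u|)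
      = (fval (redW L [a, b, c, d] e 1) : ℝ) := by
  unfold redW
  rw [fval_map_const, pow_one]
  have h1 : ∏ u ∈ L.toFinset, (if u = a ∨ u = b ∨ u = c ∨ u = d then (1 : ℝ) else |(e : ℝ) - u|)
      = ∏ u ∈ L.toFinset, (((if u ∈ [a, b, c, d] then 1 else dist1 e u : ℕ)) : ℝ) := by
    refine Finset.prod_congr rfl fun u _ => ?_
    have hiff : (u ∈ [a, b, c, d]) ↔ (u = a ∨ u = b ∨ u = c ∨ u = d) := by simp
    by_cases hu : u = a ∨ u = b ∨ u = c ∨ u = d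
    · rw [if_pos hu, if_pos (hiff.2 hu)]; simp
    · rw [if_neg hu, if_neg (fun h => hu (hiff.1 h))]
      have hne : u ≠ e := by rintro rfl; exact hu he
      exact (dist1_cast_of_ne hne).symm
  rw [h1, List.prod_toFinset _ hL, Nat.cast_list_prod, List.map_map]
  rfl

/-- `lprod` through a position map. [folklore] -/
theorem lprod_map (x : ℕ → ℝ) (g : ℕ → ℕ) (l : List ℕ) : lprod x (l.map g) = lprod (x ∘ g) l := by
  unfold lprod; rw [List.map_map]

/-! ### Repackaging a Newton-cone inequality as the checker's row -/

/-- From the Newton-cone inequality at three consecutive entries `t−1, t, t+1` of an increasing list `L` (weights `∏ dist1`), the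
checker's row `V20.rowC25 L t` for magnitudes `x` with `x i = |c_i|` at the three positions. [folklore] -/
theorem rowC25_holds_of_ineq (L : List ℕ) (t : ℕ) (x : ℕ → ℝ) {p q r : ℕ} (hp : L.getD (t - 1) 0 = p) (hq : L.getD t 0 = q)
    (hr : L.getD (t + 1) 0 = r) (hpq : p < q) (hqr : q < r)
    (key : (x (t - 1) * (((L.map (dist1 p)).prod : ℕ) : ℝ)) ^ (r - q) * (x (t + 1) * (((L.map (dist1 r)).prod : ℕ) : ℝ)) ^ (q - p)
      ≤ (x t * (((L.map (dist1 q)).prod : ℕ) : ℝ)) ^ (r - p)) :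
    (rowC25 L t).Holds x := by
  unfold Row.Holds
  have eL : (rowC25 L t).L = List.replicate (r - q) (t - 1) ++ List.replicate (q - p) (t + 1) := by
    simp only [rowC25, hp, hq, hr]
  have eR : (rowC25 L t).R = List.replicate (q - p + (r - q)) t := by
    simp only [rowC25, hp, hq, hr]
  have eBnum : fval (rowC25 L t).Bnum = (L.map (dist1 q)).prod ^ (q - p + (r - q)) := by
    simp only [rowC25, hp, hq, hr]
    exact fval_map_const _ _ _
  have eBden : fval (rowC25 L t).Bden = (L.map (dist1 p)).prod ^ (r - q) * (L.map (dist1 r)).prod ^ (q - p) := by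
    simp only [rowC25, hp, hq, hr]
    rw [fval_append, fval_map_const, fval_map_const]
  rw [eL, eR, eBnum, eBden, lprod_append, lprod_replicate, lprod_replicate, lprod_replicate]
  simp only [Nat.cast_mul, Nat.cast_pow]
  rw [show r - p = q - p + (r - q) by omega] at key
  rw [mul_pow, mul_pow, mul_pow] at key
  have k := key
  ring_nf at k ⊢
  exact k

/-! ### Erasing one position from an increasing list -/

/-- Access to a list with one index erased: live index `i` sits at position `liveSlot z i`. [folklore] -/
theorem getD_eraseIdx (L : List ℕ) (z i : ℕ) : (L.eraseIdx z).getD i 0 = L.getD (liveSlot z i) 0 := by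
  unfold liveSlot
  rw [List.getD_eq_getElem?_getD, List.getD_eq_getElem?_getD, List.getElem?_eraseIdx]
  split_ifs <;> rfl

/-- Erasing an index keeps strict increase. [folklore] -/
theorem pairwise_eraseIdx {L : List ℕ} (h : L.Pairwise (· < ·)) (z : ℕ) : (L.eraseIdx z).Pairwise (· < ·) :=
  List.Pairwise.sublist (List.eraseIdx_sublist L z) h

/-- Erasing an index of a duplicate-free list removes exactly that entry from its finset. [folklore] -/
theorem toFinset_eraseIdx {L : List ℕ} (hL : L.Nodup) {z : ℕ} (hz : z < L.length) :
    (L.eraseIdx z).toFinset = L.toFinset.erase (L.getD z 0) := by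
  ext u
  rw [List.mem_toFinset, Finset.mem_erase, List.mem_toFinset, List.getD_eq_getElem _ _ hz, List.mem_eraseIdx_iff_getElem]
  constructor
  · rintro ⟨i, hi, hik, rfl⟩
    refine ⟨fun h => hik ?_, List.getElem_mem _⟩
    exact (List.Nodup.getElem_inj_iff hL).1 h
  · rintro ⟨hne, hu⟩
    obtain ⟨i, hi, rfl⟩ := List.getElem_of_mem hu
    exact ⟨i, hi, fun h => hne (by subst h; rfl), rfl⟩

end Lists

/-! ### The `21` sums of a checked 2-Sidon order -/

section Sums

variable {dl : List ℕ} {ord : List Atom}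

/-- The sums list has length `21`. [folklore] -/
theorem length_sums (h : ordOK dl ord = true) : (sums dl ord).length = 21 := by
  unfold sums; rw [List.length_map, (ordOK_spec h).2.1]

/-- The sums increase strictly. [folklore] -/
theorem sums_pairwise (h : ordOK dl ord = true) : (sums dl ord).Pairwise (· < ·) := by
  unfold sums; rw [List.pairwise_map]; exact (ordOK_spec h).2.2.2.2

/-- The sums as the image of `Epos` over the `21` positions. [folklore] -/
theorem toFinset_sums (h : ordOK dl ord = true) : (sums dl ord).toFinset = (Finset.range 21).image (Epos dl ord) := by
  ext e
  rw [List.mem_toFinset, Finset.mem_image]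
  constructor
  · intro he
    obtain ⟨u, hu, rfl⟩ := List.getElem_of_mem he
    rw [length_sums h] at hu
    exact ⟨u, Finset.mem_range.2 hu, by rw [← sums_getD h hu, List.getD_eq_getElem _ _ (by rw [length_sums h]; exact hu)]⟩
  · rintro ⟨u, hu, rfl⟩
    rw [Finset.mem_range] at hu
    rw [← sums_getD h hu, List.getD_eq_getElem _ _ (by rw [length_sums h]; exact hu)]
    exact List.getElem_mem _

/-- The sums finset has `21` elements. [folklore] -/
theorem card_toFinset_sums (h : ordOK dl ord = true) : (sums dl ord).toFinset.card = 21 := by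
  rw [List.toFinset_card_of_nodup (sums_nodup h), length_sums h]

/-- The support of the pencil determinant lies in the sums. [folklore] -/
theorem support_subset_sums (h : ordOK dl ord = true) (S : Fin 6 → Matrix (Fin 2) (Fin 2) ℝ) :
    (pdet dl S).support ⊆ (sums dl ord).toFinset := by
  rw [toFinset_sums h]; exact support_subset h S

/-- A support element is the sum at some position. [folklore] -/
theorem exists_pos_of_mem_support (h : ordOK dl ord = true) {S : Fin 6 → Matrix (Fin 2) (Fin 2) ℝ} {e : ℕ}
    (he : e ∈ (pdet dl S).support) : ∃ u, u < 21 ∧ Epos dl ord u = e := by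
  have := support_subset h S he
  rw [Finset.mem_image] at this
  obtain ⟨u, hu, rfl⟩ := this
  exact ⟨u, Finset.mem_range.1 hu, rfl⟩

/-- No support element lies strictly between two consecutive sums. [folklore] -/
theorem no_support_between (h : ordOK dl ord = true) {S : Fin 6 → Matrix (Fin 2) (Fin 2) ℝ} {t : ℕ} (ht : t + 1 < 21) :
    ∀ u ∈ (pdet dl S).support, ¬ (Epos dl ord t < u ∧ u < Epos dl ord (t + 1)) := by
  intro u hu ⟨h1, h2⟩
  obtain ⟨w, hw, rfl⟩ := exists_pos_of_mem_support h hu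
  have hwt : t < w := by
    by_contra hle; push Not at hle
    exact absurd h1 (not_lt.2 (Epos_le h hle (by omega)))
  have hwt' : w < t + 1 := by
    by_contra hle; push Not at hle
    exact absurd h2 (not_lt.2 (Epos_le h hle hw))
  omega

/-- No support element lies strictly between the sums at positions `t` and `t + 2` when the sum at `t + 1` is not in the support. [folklore] -/
theorem no_support_between_two (h : ordOK dl ord = true) {S : Fin 6 → Matrix (Fin 2) (Fin 2) ℝ} {t : ℕ} (ht : t + 2 < 21)
    (hz : Epos dl ord (t + 1) ∉ (pdet dl S).support) :
    ∀ u ∈ (pdet dl S).support, ¬ (Epos dl ord t < u ∧ u < Epos dl ord (t + 2)) := by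
  intro u hu ⟨h1, h2⟩
  obtain ⟨w, hw, rfl⟩ := exists_pos_of_mem_support h hu
  have hwt : t < w := by
    by_contra hle; push Not at hle
    exact absurd h1 (not_lt.2 (Epos_le h hle (by omega)))
  have hwt' : w < t + 2 := by
    by_contra hle; push Not at hle
    exact absurd h2 (not_lt.2 (Epos_le h hle hw))
  obtain rfl : w = t + 1 := by omega
  exact hz hu

/-- The atom at a position and the coefficient dictionary: `coeff (E t) = aval (atom at t)`, and the atom `a` sits at position
`posOf a ord`. [folklore] -/
theorem coeff_Epos_posOf (h : ordOK dl ord = true) {S : Fin 6 → Matrix (Fin 2) (Fin 2) ℝ} (hS : ∀ l, (S l).IsSymm) {a : Atom}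
    (ha : a ∈ allAtoms) : (pdet dl S).coeff (Epos dl ord (posOf a ord)) = aval S a := by
  rw [V20.coeff_Epos h hS (posOf_lt h ha), getD_posOf ((ordOK_spec h).2.2.1 a ha)]

end Sums

/-! ### The `20` live sums of mode `B z` -/

section Live

variable {dl : List ℕ} {ord : List Atom}

/-- The live sums increase strictly. [folklore] -/
theorem live_pairwise (h : ordOK dl ord = true) (z : ℕ) : ((sums dl ord).eraseIdx z).Pairwise (· < ·) :=
  pairwise_eraseIdx (sums_pairwise h) z

/-- The live sums are duplicate free. [folklore] -/
theorem live_nodup (h : ordOK dl ord = true) (z : ℕ) : ((sums dl ord).eraseIdx z).Nodup :=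
  (live_pairwise h z).imp ne_of_lt

/-- There are `20` live sums. [folklore] -/
theorem length_live (h : ordOK dl ord = true) {z : ℕ} (hz : z < 21) : ((sums dl ord).eraseIdx z).length = 20 := by
  rw [List.length_eraseIdx_of_lt (by rw [length_sums h]; exact hz), length_sums h]

/-- Live index `i` is the sum at position `liveSlot z i`. [folklore] -/
theorem live_getD (h : ordOK dl ord = true) (z : ℕ) {i : ℕ} (hi : i < 20) :
    ((sums dl ord).eraseIdx z).getD i 0 = Epos dl ord (liveSlot z i) := by
  rw [getD_eraseIdx, sums_getD h (by unfold liveSlot; split_ifs <;> omega)]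

/-- The live sums as a finset: all sums but the one at position `z`. [folklore] -/
theorem toFinset_live (h : ordOK dl ord = true) {z : ℕ} (hz : z < 21) :
    ((sums dl ord).eraseIdx z).toFinset = (sums dl ord).toFinset.erase (Epos dl ord z) := by
  rw [toFinset_eraseIdx (sums_nodup h) (by rw [length_sums h]; exact hz), sums_getD h hz]

/-- The live sums finset has `20` elements. [folklore] -/
theorem card_toFinset_live (h : ordOK dl ord = true) {z : ℕ} (hz : z < 21) : ((sums dl ord).eraseIdx z).toFinset.card = 20 := by
  rw [List.toFinset_card_of_nodup (live_nodup h z), length_live h hz]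

/-- `liveSlot` is below `21` on live indices. [folklore] -/
theorem liveSlot_lt {z i : ℕ} (hi : i < 20) : liveSlot z i < 21 := by
  unfold liveSlot; split_ifs <;> omega

/-- `liveSlot` never hits the dead position. [folklore] -/
theorem liveSlot_ne (z i : ℕ) : liveSlot z i ≠ z := by
  unfold liveSlot; split_ifs <;> omega

/-- `liveSlot` is strictly increasing. [folklore] -/
theorem liveSlot_lt_liveSlot {z i j : ℕ} (hij : i < j) : liveSlot z i < liveSlot z j := by
  unfold liveSlot; split_ifs <;> omega

end Live

end Summit.ValiantsHypothesis.ValiantsHypothesis.Theorems.LacunarySymmetroidMatrixDescartes.Census.V19S
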